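import Summits.CriticalPhenomena.PercolationContinuityZ3.Theorems.PercNearOneGluingNoHeavyQuantDepthOneSubTwoPointwise
import HarnessLib

/-!
# QUANT lane R8, GRADED-CLOSURE programme: G₀ for EVERY PARTNER OF MEAN AT MOST TWO — part 2, the row theorem

builds on p205010 (kernel theorem, internal audit signed; external expert review pending)

Support file (`--supports stmt-CriticalPhenomena-4575`), QUANT lane seat prim-quant-arm-1 (gen 44, architect seat, own initiative on the unowned node
'G₀ for a general partner'), rung R8 of `run/shared/lean/prim/quant/LADDER.md`; memo `run/shared/lean/prim/quant/prim-quant-arm-1-g44/G0-SUBUNIT-G44.md`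
§5.  Part 2 of 2 (part 1 `…QuantDepthOneSubTwoPointwise`: `subtwo_pointwise`).  Theorems only, standard axioms, no sorries; imports part 1 and,
through it, `…QuantDepthOneSubUnitRow` (✓ p383717) for `tlc_functional`.

STATEMENT (`subtwoConv_twoLayerRow_of_tlc`).  Floor `0 < y < 1` (ANY floor), `u = y/(1−y)`; `μ₁ ≥ 0` on `{0..M₁}` with the depth-1 family
`LawDec.TLC y T₁ M₁ μ₁`; `μ₂ ≥ 0` on `{0..M₂}` of which ONLY the row `u·μ₂ 0 ≤ Σ_{g₂ ≤ b ≤ M₂} μ₂ b` is used (`g₂ ∈ {1,2}`, `T₂ ≤ g₂`; with `g₂ = ⌈T₂⌉`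
its two-layer row `d = 0`); `0 < T₂ ≤ 2` (the partner's mean in the application: its only low atom is `0` — gated relays at any gate, gated pairs / blobs
`{0,m}` with `gm ≤ 2`, any law of mean `≤ 2`); `2d < T₁`; `j₀ < T₁+T₂−d ≤ j₀+1`, `j₀ < M₁`; and the TOP hole heavy: `T₁ − d < j₀ → usage y T₁ j₀ d j₀ ≥ 1`
(automatic when `T₁ − 2d ≥ 2`, `subtwo_hole_heavy_of_two_le_depth`; the other possible hole `j₀ − 1` is then heavy by `usage_anti_mid`).
CONCLUSION: the two-layer row `d` of `lconv M₁ M₂ μ₁ μ₂` at target `T₁ + T₂`.  No mass / mean / top-affordability hypothesis on either factor.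
CERTIFICATE (`subtwo_pointwise`): holes = atoms `h` with `T₁−d < h ≤ j₀` (`⊆ {j₀−1, j₀}`), `κ_h = 1/usage(d,h)`, `κ₀ ≤ κ₁ ≤ 1`; column `0`: `TLC(j₀,d)`;
columns `1 ≤ b < g₂`: `TLC(j₀−b, d−b)`; columns `g₂ ≤ b ≤ d`: `(1−κ₁)TLC(j₀−b,d−b) + κ₁TLC(j₀,d−b)` (room `κ₁` on `[j₀−b+1, j₀] ∋` both holes since
`j₀ ≤ ⌊T₁−d⌋ + g₂`); hole atoms carry the partner row `× κ_h`.  Every cell an identity or a sign.  `T₂ ≤ 1` (`g₂ = 1`) is the companion file's theorem.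
EVIDENCE: extracted from exact full-grid tensor LPs (engine `quant/prim-quant-arm-1-g44/code/`), verified exactly on 141 536 cells (`y ∈ [1/10,3/4]`, `M₁ ≤ 30`,
`M₂ ≤ 11`, all `T₂ ≤ 2`, every admissible `d`): 0 failures whenever the top hole is heavy; every failure of the formula has `κ₁ > 1`.  HONEST STATUS: support
lemma for the OPEN node G₀ (`LawDec.TLCGateConvTLB`); partners of mean `> 2` and the shallow top band (`κ₁ > 1`) remain; RATE class log\* / honest sentence of
`run/shared/lean/prim/quant/README.md` unchanged.
[this work]; relay case / depth-1 rows: prim-quant-census-2 g63/g64; tensor principle: prim-quant-arm-2 g38; `usage_anti_mid`: this lane.  Nothing here is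
cited as a published result.  The gluing rows served [cite: KozmaNitzan2024, Conjecture 3 (p. 15)]; product measure [cite: Grimmett1999, §1.3 p. 10].
-/

noncomputable section

namespace Summit.CriticalPhenomena.PercolationContinuityZ3.Theorems

namespace Quant

open Finset

namespace LawDec

/-- **G₀ FOR EVERY PARTNER OF MEAN AT MOST TWO (q = 1, any floor).**  From the depth-1 family `TLC y T₁ M₁ μ₁` of the first factor and the
single partner row `u·μ₂ 0 ≤ Σ_{g₂ ≤ b ≤ M₂} μ₂ b` (`g₂ = ⌈T₂⌉ ∈ {1, 2}`: the partner's two-layer row `d = 0`), the two-layer row `d` of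
`lconv M₁ M₂ μ₁ μ₂` at target `T₁ + T₂`, for every `0 < T₂ ≤ 2`, `2d < T₁`, product layer `j₀` (`j₀ < T₁+T₂−d ≤ j₀+1`, `j₀ < M₁`) whose top hole
is heavy (`T₁ − d < j₀ → 1 ≤ usage y T₁ j₀ d j₀`; automatic when `T₁ − 2d ≥ 2`).  Certificate: column `0`: `TLC(j₀,d)`; columns `1 ≤ b < g₂`:
`TLC(j₀−b, d−b)`; columns `g₂ ≤ b ≤ d`: `(1−κ₁)TLC(j₀−b,d−b) + κ₁TLC(j₀,d−b)`; atoms `j₀`, `j₀−1`: the partner row `× κ₁`, `× κ₀` (the two possible mids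
of column `0`, `κ = 1/usage`, `κ₀ ≤ κ₁` by `usage_anti_mid`).  Contains `subunitConv_twoLayerRow_of_tlc` (`T₂ ≤ 1`, `g₂ = 1`).  No mass, mean or
top-affordability hypothesis on either factor.  Exact sweep of the certificate: 141 536 cells / 0 (memo §5). [this work] -/
theorem subtwoConv_twoLayerRow_of_tlc (y T₁ T₂ : ℝ) (M₁ M₂ d j₀ g₂ : ℕ) (μ₁ μ₂ : ℕ → ℝ)
    (hy0 : 0 < y) (hy1 : y < 1) (h10 : ∀ a, 0 ≤ μ₁ a) (h20 : ∀ b, 0 ≤ μ₂ b)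
    (hT20 : 0 < T₂) (hg2b : T₂ ≤ (g₂ : ℝ)) (hg22 : g₂ ≤ 2) (hlow : 2 * (d : ℝ) < T₁)
    (hj0 : (j₀ : ℝ) < T₁ + T₂ - d) (hj0' : T₁ + T₂ - d ≤ (j₀ : ℝ) + 1) (hj0M : j₀ < M₁)
    (hTLC : TLC y T₁ M₁ μ₁)
    (hTLB2 : y / (1 - y) * μ₂ 0 ≤ ∑ b ∈ Finset.range (M₂ + 1), (if g₂ ≤ b then μ₂ b else 0))
    (hheavy : T₁ - d < (j₀ : ℝ) → 1 ≤ usage y T₁ j₀ d j₀) :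
    y / (1 - y) * ∑ h ∈ Finset.range (d + 1), lconv M₁ M₂ μ₁ μ₂ h
      ≤ ∑ h ∈ Finset.range (M₁ + M₂ + 1), (if T₁ + T₂ - d ≤ (h : ℝ) then lconv M₁ M₂ μ₁ μ₂ h else 0) := by
  classical
  have h1y : 0 < 1 - y := by linarith
  have hu0 : 0 < y / (1 - y) := div_pos hy0 h1y
  have hdj : d ≤ j₀ := by
    have : (d : ℝ) < j₀ + 1 := by linarith
    have : d < j₀ + 1 := by exact_mod_cast this
    omega
  have hdM : d + 1 ≤ M₁ + M₂ + 1 := by omega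
  have hg2r : (g₂ : ℝ) ≤ 2 := by exact_mod_cast hg22
  -- the two hole weights
  set κ₁ : ℝ := if T₁ - d < (j₀ : ℝ) then 1 / usage y T₁ j₀ d j₀ else 0 with hκ1def
  set κ₀ : ℝ := if T₁ - d + 1 < (j₀ : ℝ) then 1 / usage y T₁ j₀ d (j₀ - 1) else 0 with hκ0def
  have hκ1h : T₁ - d < (j₀ : ℝ) → κ₁ = 1 / usage y T₁ j₀ d j₀ := fun h => by rw [hκ1def, if_pos h]
  have hκ0h : T₁ - d + 1 < (j₀ : ℝ) → κ₀ = 1 / usage y T₁ j₀ d (j₀ - 1) := fun h => by rw [hκ0def, if_pos h]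
  have hκ0n : ¬ (T₁ - d + 1 < (j₀ : ℝ)) → κ₀ = 0 := fun h => by rw [hκ0def, if_neg h]
  have hκ11 : κ₁ ≤ 1 := by
    rw [hκ1def]; split_ifs with h
    · rw [div_le_one (lt_of_lt_of_le zero_lt_one (hheavy h))]; exact hheavy h
    · exact zero_le_one
  have hfacts : T₁ - d + 1 < (j₀ : ℝ) →
      T₁ - d < (j₀ : ℝ) ∧ usage y T₁ j₀ d j₀ ≤ usage y T₁ j₀ d (j₀ - 1) := by
    intro h
    have hd0 : (0 : ℝ) ≤ d := Nat.cast_nonneg d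
    have hj1 : 1 ≤ j₀ := by
      have : (1 : ℝ) < j₀ := by linarith
      have : 1 < j₀ := by exact_mod_cast this
      omega
    have hcast : ((j₀ - 1 : ℕ) : ℝ) = (j₀ : ℝ) - 1 := by rw [Nat.cast_sub hj1]; push_cast; ring
    refine ⟨by linarith, ?_⟩
    exact usage_anti_mid y T₁ j₀ d (j₀ - 1) j₀ hy0 hy1 (by omega) le_rfl hlow (by rw [hcast]; linarith)
  have hκ00 : 0 ≤ κ₀ := by
    rw [hκ0def]; split_ifs with h
    · obtain ⟨h', hmono⟩ := hfacts h
      exact div_nonneg zero_le_one (le_trans (le_trans zero_le_one (hheavy h')) hmono)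
    · exact le_rfl
  have hκ01 : κ₀ ≤ κ₁ := by
    rw [hκ0def]; split_ifs with h
    · obtain ⟨h', hmono⟩ := hfacts h
      rw [hκ1h h']
      have hpos : 0 < usage y T₁ j₀ d j₀ := lt_of_lt_of_le zero_lt_one (hheavy h')
      exact one_div_le_one_div_of_le hpos hmono
    · rw [hκ1def]; split_ifs with h'
      · exact div_nonneg zero_le_one (le_trans zero_le_one (hheavy h'))
      · exact le_rfl
  -- a test function against the convolution (the identity `LawDec.sum_fun_mul_lconv` of arm-2 g38, re-derived inline)
  have hconv : ∀ φ : ℕ → ℝ, ∑ h ∈ Finset.range (M₁ + M₂ + 1), φ h * lconv M₁ M₂ μ₁ μ₂ h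
      = ∑ a ∈ Finset.range (M₁ + 1), ∑ s ∈ Finset.range (M₂ + 1), φ (a + s) * (μ₁ a * μ₂ s) := by
    intro φ
    simp only [lconv, Finset.mul_sum]; rw [Finset.sum_comm]
    refine Finset.sum_congr rfl fun a ha => ?_
    rw [Finset.sum_comm]
    refine Finset.sum_congr rfl fun s hs => ?_
    rw [Finset.mem_range] at ha hs
    have e : ∀ h : ℕ, φ h * (if a + s = h then μ₁ a * μ₂ s else 0) = if a + s = h then φ (a + s) * (μ₁ a * μ₂ s) else 0 := by
      intro h; split_ifs with hh; · rw [hh]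
      rw [mul_zero]
    simp_rw [e]
    rw [Finset.sum_ite_eq (Finset.range (M₁ + M₂ + 1)) (a + s), if_pos (Finset.mem_range.2 (by omega))]
  set ν := lconv M₁ M₂ μ₁ μ₂ with hν
  have hL : ∑ h ∈ Finset.range (d + 1), ν h = ∑ h ∈ Finset.range (M₁ + M₂ + 1), (if h ≤ d then (1 : ℝ) else 0) * ν h := by
    rw [← Finset.sum_range_add_sum_Ico _ hdM]
    have e1 : ∑ h ∈ Finset.range (d + 1), (if h ≤ d then (1 : ℝ) else 0) * ν h = ∑ h ∈ Finset.range (d + 1), ν h :=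
      Finset.sum_congr rfl fun h hh => by rw [if_pos (by rw [Finset.mem_range] at hh; omega), one_mul]
    have e2 : ∑ h ∈ Finset.Ico (d + 1) (M₁ + M₂ + 1), (if h ≤ d then (1 : ℝ) else 0) * ν h = 0 :=
      Finset.sum_eq_zero fun h hh => by rw [Finset.mem_Ico] at hh; rw [if_neg (by omega), zero_mul]
    rw [e1, e2, add_zero]
  have hR : ∑ h ∈ Finset.range (M₁ + M₂ + 1), (if T₁ + T₂ - d ≤ (h : ℝ) then ν h else 0)
      = ∑ h ∈ Finset.range (M₁ + M₂ + 1), (if T₁ + T₂ - d ≤ (h : ℝ) then (1 : ℝ) else 0) * ν h :=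
    Finset.sum_congr rfl fun h _ => by split_ifs <;> simp
  rw [hL, hR, Finset.mul_sum]
  have hK : ∑ h ∈ Finset.range (M₁ + M₂ + 1), y / (1 - y) * ((if h ≤ d then (1 : ℝ) else 0) * ν h)
        - ∑ h ∈ Finset.range (M₁ + M₂ + 1), (if T₁ + T₂ - d ≤ (h : ℝ) then (1 : ℝ) else 0) * ν h
      = ∑ h ∈ Finset.range (M₁ + M₂ + 1),
          (y / (1 - y) * (if h ≤ d then (1 : ℝ) else 0) - (if T₁ + T₂ - d ≤ (h : ℝ) then (1 : ℝ) else 0)) * ν h := by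
    rw [← Finset.sum_sub_distrib]
    exact Finset.sum_congr rfl fun h _ => by ring
  rw [← sub_nonpos, hK, hν, hconv]
  -- the pointwise certificate, cell by cell, as three H-pieces + the partner piece
  have hcell : ∀ a ∈ Finset.range (M₁ + 1), ∀ b ∈ Finset.range (M₂ + 1),
      (y / (1 - y) * (if a + b ≤ d then (1 : ℝ) else 0) - (if T₁ + T₂ - d ≤ ((a + b : ℕ) : ℝ) then (1 : ℝ) else 0)) * (μ₁ a * μ₂ b)
        ≤ μ₂ b * ((if b = 0 then (y / (1 - y) * (if a ≤ d then (1 : ℝ) else 0) - (if j₀ + 1 ≤ a then (1 : ℝ) else 0) - y / (1 - y) * (if a ≤ j₀ ∧ T₁ < ((d : ℕ) : ℝ) + a then 1 / usage y T₁ j₀ d a else 0)) else 0) * μ₁ a)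
          + μ₂ b * ((if 1 ≤ b ∧ b < g₂ ∧ b ≤ d then (y / (1 - y) * (if a ≤ (d - b) then (1 : ℝ) else 0) - (if (j₀ - b) + 1 ≤ a then (1 : ℝ) else 0) - y / (1 - y) * (if a ≤ (j₀ - b) ∧ T₁ < ((d - b : ℕ) : ℝ) + a then 1 / usage y T₁ (j₀ - b) (d - b) a else 0)) else 0) * μ₁ a)
          + μ₂ b * ((if g₂ ≤ b ∧ b ≤ d then (1 - κ₁) * (y / (1 - y) * (if a ≤ (d - b) then (1 : ℝ) else 0) - (if (j₀ - b) + 1 ≤ a then (1 : ℝ) else 0) - y / (1 - y) * (if a ≤ (j₀ - b) ∧ T₁ < ((d - b : ℕ) : ℝ) + a then 1 / usage y T₁ (j₀ - b) (d - b) a else 0)) + κ₁ * (y / (1 - y) * (if a ≤ (d - b) then (1 : ℝ) else 0) - (if j₀ + 1 ≤ a then (1 : ℝ) else 0) - y / (1 - y) * (if a ≤ j₀ ∧ T₁ < ((d - b : ℕ) : ℝ) + a then 1 / usage y T₁ j₀ (d - b) a else 0)) else 0) * μ₁ a)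
          + (((if a = j₀ then κ₁ else 0) + (if a + 1 = j₀ then κ₀ else 0)) * μ₁ a) * ((y / (1 - y) * (if b = 0 then (1 : ℝ) else 0) - (if g₂ ≤ b then (1 : ℝ) else 0)) * μ₂ b) := by
    intro a _ b _
    have hp := subtwo_pointwise y T₁ T₂ κ₁ κ₀ d j₀ g₂ a b hy0 hy1 hT20 hg2b hg22 hlow hj0 hj0' hκ00 hκ01 hκ11 hκ1h hκ0h hκ0n
    have hw : 0 ≤ μ₁ a * μ₂ b := mul_nonneg (h10 a) (h20 b)
    have := mul_le_mul_of_nonneg_right hp hw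
    have e : ((if b = 0 then (y / (1 - y) * (if a ≤ d then (1 : ℝ) else 0) - (if j₀ + 1 ≤ a then (1 : ℝ) else 0) - y / (1 - y) * (if a ≤ j₀ ∧ T₁ < ((d : ℕ) : ℝ) + a then 1 / usage y T₁ j₀ d a else 0)) else 0)
        + (if 1 ≤ b ∧ b < g₂ ∧ b ≤ d then (y / (1 - y) * (if a ≤ (d - b) then (1 : ℝ) else 0) - (if (j₀ - b) + 1 ≤ a then (1 : ℝ) else 0) - y / (1 - y) * (if a ≤ (j₀ - b) ∧ T₁ < ((d - b : ℕ) : ℝ) + a then 1 / usage y T₁ (j₀ - b) (d - b) a else 0)) else 0)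
        + (if g₂ ≤ b ∧ b ≤ d then (1 - κ₁) * (y / (1 - y) * (if a ≤ (d - b) then (1 : ℝ) else 0) - (if (j₀ - b) + 1 ≤ a then (1 : ℝ) else 0) - y / (1 - y) * (if a ≤ (j₀ - b) ∧ T₁ < ((d - b : ℕ) : ℝ) + a then 1 / usage y T₁ (j₀ - b) (d - b) a else 0)) + κ₁ * (y / (1 - y) * (if a ≤ (d - b) then (1 : ℝ) else 0) - (if j₀ + 1 ≤ a then (1 : ℝ) else 0) - y / (1 - y) * (if a ≤ j₀ ∧ T₁ < ((d - b : ℕ) : ℝ) + a then 1 / usage y T₁ j₀ (d - b) a else 0)) else 0)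
        + ((if a = j₀ then κ₁ else 0) + (if a + 1 = j₀ then κ₀ else 0)) * (y / (1 - y) * (if b = 0 then (1 : ℝ) else 0) - (if g₂ ≤ b then (1 : ℝ) else 0))) * (μ₁ a * μ₂ b)
        = μ₂ b * ((if b = 0 then (y / (1 - y) * (if a ≤ d then (1 : ℝ) else 0) - (if j₀ + 1 ≤ a then (1 : ℝ) else 0) - y / (1 - y) * (if a ≤ j₀ ∧ T₁ < ((d : ℕ) : ℝ) + a then 1 / usage y T₁ j₀ d a else 0)) else 0) * μ₁ a)
          + μ₂ b * ((if 1 ≤ b ∧ b < g₂ ∧ b ≤ d then (y / (1 - y) * (if a ≤ (d - b) then (1 : ℝ) else 0) - (if (j₀ - b) + 1 ≤ a then (1 : ℝ) else 0) - y / (1 - y) * (if a ≤ (j₀ - b) ∧ T₁ < ((d - b : ℕ) : ℝ) + a then 1 / usage y T₁ (j₀ - b) (d - b) a else 0)) else 0) * μ₁ a)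
          + μ₂ b * ((if g₂ ≤ b ∧ b ≤ d then (1 - κ₁) * (y / (1 - y) * (if a ≤ (d - b) then (1 : ℝ) else 0) - (if (j₀ - b) + 1 ≤ a then (1 : ℝ) else 0) - y / (1 - y) * (if a ≤ (j₀ - b) ∧ T₁ < ((d - b : ℕ) : ℝ) + a then 1 / usage y T₁ (j₀ - b) (d - b) a else 0)) + κ₁ * (y / (1 - y) * (if a ≤ (d - b) then (1 : ℝ) else 0) - (if j₀ + 1 ≤ a then (1 : ℝ) else 0) - y / (1 - y) * (if a ≤ j₀ ∧ T₁ < ((d - b : ℕ) : ℝ) + a then 1 / usage y T₁ j₀ (d - b) a else 0)) else 0) * μ₁ a)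
          + (((if a = j₀ then κ₁ else 0) + (if a + 1 = j₀ then κ₀ else 0)) * μ₁ a) * ((y / (1 - y) * (if b = 0 then (1 : ℝ) else 0) - (if g₂ ≤ b then (1 : ℝ) else 0)) * μ₂ b) := by
      ring
    linarith [this, e]
  refine le_trans (Finset.sum_le_sum fun a ha => Finset.sum_le_sum fun b hb => hcell a ha b hb) ?_
  rw [show (∑ a ∈ Finset.range (M₁ + 1), ∑ b ∈ Finset.range (M₂ + 1),
      (μ₂ b * ((if b = 0 then (y / (1 - y) * (if a ≤ d then (1 : ℝ) else 0) - (if j₀ + 1 ≤ a then (1 : ℝ) else 0) - y / (1 - y) * (if a ≤ j₀ ∧ T₁ < ((d : ℕ) : ℝ) + a then 1 / usage y T₁ j₀ d a else 0)) else 0) * μ₁ a)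
        + μ₂ b * ((if 1 ≤ b ∧ b < g₂ ∧ b ≤ d then (y / (1 - y) * (if a ≤ (d - b) then (1 : ℝ) else 0) - (if (j₀ - b) + 1 ≤ a then (1 : ℝ) else 0) - y / (1 - y) * (if a ≤ (j₀ - b) ∧ T₁ < ((d - b : ℕ) : ℝ) + a then 1 / usage y T₁ (j₀ - b) (d - b) a else 0)) else 0) * μ₁ a)
        + μ₂ b * ((if g₂ ≤ b ∧ b ≤ d then (1 - κ₁) * (y / (1 - y) * (if a ≤ (d - b) then (1 : ℝ) else 0) - (if (j₀ - b) + 1 ≤ a then (1 : ℝ) else 0) - y / (1 - y) * (if a ≤ (j₀ - b) ∧ T₁ < ((d - b : ℕ) : ℝ) + a then 1 / usage y T₁ (j₀ - b) (d - b) a else 0)) + κ₁ * (y / (1 - y) * (if a ≤ (d - b) then (1 : ℝ) else 0) - (if j₀ + 1 ≤ a then (1 : ℝ) else 0) - y / (1 - y) * (if a ≤ j₀ ∧ T₁ < ((d - b : ℕ) : ℝ) + a then 1 / usage y T₁ j₀ (d - b) a else 0)) else 0) * μ₁ a)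
        + (((if a = j₀ then κ₁ else 0) + (if a + 1 = j₀ then κ₀ else 0)) * μ₁ a) * ((y / (1 - y) * (if b = 0 then (1 : ℝ) else 0) - (if g₂ ≤ b then (1 : ℝ) else 0)) * μ₂ b)))
    = (∑ b ∈ Finset.range (M₂ + 1), μ₂ b * ((if b = 0 then (1 : ℝ) else 0)
          * ∑ a ∈ Finset.range (M₁ + 1), μ₁ a * (y / (1 - y) * (if a ≤ d then (1 : ℝ) else 0) - (if j₀ + 1 ≤ a then (1 : ℝ) else 0) - y / (1 - y) * (if a ≤ j₀ ∧ T₁ < ((d : ℕ) : ℝ) + a then 1 / usage y T₁ j₀ d a else 0))))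
      + (∑ b ∈ Finset.range (M₂ + 1), μ₂ b * ((if 1 ≤ b ∧ b < g₂ ∧ b ≤ d then (1 : ℝ) else 0)
          * ∑ a ∈ Finset.range (M₁ + 1), μ₁ a * (y / (1 - y) * (if a ≤ (d - b) then (1 : ℝ) else 0) - (if (j₀ - b) + 1 ≤ a then (1 : ℝ) else 0) - y / (1 - y) * (if a ≤ (j₀ - b) ∧ T₁ < ((d - b : ℕ) : ℝ) + a then 1 / usage y T₁ (j₀ - b) (d - b) a else 0))))
      + (∑ b ∈ Finset.range (M₂ + 1), μ₂ b * (if g₂ ≤ b ∧ b ≤ d then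
          (1 - κ₁) * ∑ a ∈ Finset.range (M₁ + 1), μ₁ a * (y / (1 - y) * (if a ≤ (d - b) then (1 : ℝ) else 0) - (if (j₀ - b) + 1 ≤ a then (1 : ℝ) else 0) - y / (1 - y) * (if a ≤ (j₀ - b) ∧ T₁ < ((d - b : ℕ) : ℝ) + a then 1 / usage y T₁ (j₀ - b) (d - b) a else 0))
            + κ₁ * ∑ a ∈ Finset.range (M₁ + 1), μ₁ a * (y / (1 - y) * (if a ≤ (d - b) then (1 : ℝ) else 0) - (if j₀ + 1 ≤ a then (1 : ℝ) else 0) - y / (1 - y) * (if a ≤ j₀ ∧ T₁ < ((d - b : ℕ) : ℝ) + a then 1 / usage y T₁ j₀ (d - b) a else 0)) else 0))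
      + (∑ a ∈ Finset.range (M₁ + 1), ((if a = j₀ then κ₁ else 0) + (if a + 1 = j₀ then κ₀ else 0)) * μ₁ a)
          * ∑ b ∈ Finset.range (M₂ + 1), (y / (1 - y) * (if b = 0 then (1 : ℝ) else 0) - (if g₂ ≤ b then (1 : ℝ) else 0)) * μ₂ b from ?_]
  · have hA : ∑ b ∈ Finset.range (M₂ + 1), μ₂ b * ((if b = 0 then (1 : ℝ) else 0)
          * ∑ a ∈ Finset.range (M₁ + 1), μ₁ a * (y / (1 - y) * (if a ≤ d then (1 : ℝ) else 0) - (if j₀ + 1 ≤ a then (1 : ℝ) else 0) - y / (1 - y) * (if a ≤ j₀ ∧ T₁ < ((d : ℕ) : ℝ) + a then 1 / usage y T₁ j₀ d a else 0))) ≤ 0 := by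
      refine Finset.sum_nonpos fun b _ => ?_
      split_ifs
      · rw [one_mul]
        exact mul_nonpos_of_nonneg_of_nonpos (h20 b) (tlc_functional hTLC hj0M hdj hlow)
      · rw [zero_mul, mul_zero]
    have hB1 : ∑ b ∈ Finset.range (M₂ + 1), μ₂ b * ((if 1 ≤ b ∧ b < g₂ ∧ b ≤ d then (1 : ℝ) else 0)
          * ∑ a ∈ Finset.range (M₁ + 1), μ₁ a * (y / (1 - y) * (if a ≤ (d - b) then (1 : ℝ) else 0) - (if (j₀ - b) + 1 ≤ a then (1 : ℝ) else 0) - y / (1 - y) * (if a ≤ (j₀ - b) ∧ T₁ < ((d - b : ℕ) : ℝ) + a then 1 / usage y T₁ (j₀ - b) (d - b) a else 0))) ≤ 0 := by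
      refine Finset.sum_nonpos fun b _ => ?_
      split_ifs with hb
      · have hcast : ((d - b : ℕ) : ℝ) = (d : ℝ) - b := by rw [Nat.cast_sub hb.2.2]
        have hb0 : (0 : ℝ) ≤ b := Nat.cast_nonneg b
        have hlow' : 2 * ((d - b : ℕ) : ℝ) < T₁ := by rw [hcast]; linarith
        rw [one_mul]
        exact mul_nonpos_of_nonneg_of_nonpos (h20 b)
          (tlc_functional hTLC (show j₀ - b < M₁ by omega) (show d - b ≤ j₀ - b by omega) hlow')
      · rw [zero_mul, mul_zero]
    have hB2 : ∑ b ∈ Finset.range (M₂ + 1), μ₂ b * (if g₂ ≤ b ∧ b ≤ d then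
          (1 - κ₁) * ∑ a ∈ Finset.range (M₁ + 1), μ₁ a * (y / (1 - y) * (if a ≤ (d - b) then (1 : ℝ) else 0) - (if (j₀ - b) + 1 ≤ a then (1 : ℝ) else 0) - y / (1 - y) * (if a ≤ (j₀ - b) ∧ T₁ < ((d - b : ℕ) : ℝ) + a then 1 / usage y T₁ (j₀ - b) (d - b) a else 0))
            + κ₁ * ∑ a ∈ Finset.range (M₁ + 1), μ₁ a * (y / (1 - y) * (if a ≤ (d - b) then (1 : ℝ) else 0) - (if j₀ + 1 ≤ a then (1 : ℝ) else 0) - y / (1 - y) * (if a ≤ j₀ ∧ T₁ < ((d - b : ℕ) : ℝ) + a then 1 / usage y T₁ j₀ (d - b) a else 0)) else 0) ≤ 0 := by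
      refine Finset.sum_nonpos fun b _ => ?_
      split_ifs with hb
      · have hcast : ((d - b : ℕ) : ℝ) = (d : ℝ) - b := by rw [Nat.cast_sub hb.2]
        have hb0 : (0 : ℝ) ≤ b := Nat.cast_nonneg b
        have hlow' : 2 * ((d - b : ℕ) : ℝ) < T₁ := by rw [hcast]; linarith
        have h1 := tlc_functional hTLC (show j₀ - b < M₁ by omega) (show d - b ≤ j₀ - b by omega) hlow'
        have h2 := tlc_functional hTLC hj0M (show d - b ≤ j₀ by omega) hlow'
        have hk' : 0 ≤ 1 - κ₁ := by linarith
        have hκ10 : 0 ≤ κ₁ := le_trans hκ00 hκ01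
        exact mul_nonpos_of_nonneg_of_nonpos (h20 b) (by nlinarith)
      · rw [mul_zero]
    have hC : (∑ a ∈ Finset.range (M₁ + 1), ((if a = j₀ then κ₁ else 0) + (if a + 1 = j₀ then κ₀ else 0)) * μ₁ a)
          * ∑ b ∈ Finset.range (M₂ + 1), (y / (1 - y) * (if b = 0 then (1 : ℝ) else 0) - (if g₂ ≤ b then (1 : ℝ) else 0)) * μ₂ b ≤ 0 := by
      have hκ10 : 0 ≤ κ₁ := le_trans hκ00 hκ01
      have hw : 0 ≤ ∑ a ∈ Finset.range (M₁ + 1), ((if a = j₀ then κ₁ else 0) + (if a + 1 = j₀ then κ₀ else 0)) * μ₁ a := by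
        refine Finset.sum_nonneg fun a _ => mul_nonneg ?_ (h10 a)
        refine add_nonneg ?_ ?_ <;> split_ifs
        exacts [hκ10, le_rfl, hκ00, le_rfl]
      have hSle : ∑ b ∈ Finset.range (M₂ + 1), (y / (1 - y) * (if b = 0 then (1 : ℝ) else 0) - (if g₂ ≤ b then (1 : ℝ) else 0)) * μ₂ b ≤ 0 := by
        have e : ∀ b ∈ Finset.range (M₂ + 1), (y / (1 - y) * (if b = 0 then (1 : ℝ) else 0) - (if g₂ ≤ b then (1 : ℝ) else 0)) * μ₂ b
            = y / (1 - y) * (if b = 0 then μ₂ b else 0) - (if g₂ ≤ b then μ₂ b else 0) := by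
          intro b _; split_ifs <;> ring
        rw [Finset.sum_congr rfl e, Finset.sum_sub_distrib, ← Finset.mul_sum, Finset.sum_ite_eq' (Finset.range (M₂ + 1)) 0,
          if_pos (Finset.mem_range.2 (Nat.succ_pos M₂))]
        linarith
      exact mul_nonpos_of_nonneg_of_nonpos hw hSle
    linarith
  · -- the rearrangement identity
    simp_rw [Finset.sum_add_distrib]
    congr 1
    · congr 1
      · congr 1
        · rw [Finset.sum_comm]
          refine Finset.sum_congr rfl fun b _ => ?_
          rw [Finset.mul_sum, Finset.mul_sum]
          refine Finset.sum_congr rfl fun a _ => ?_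
          by_cases hb : b = 0
          · rw [if_pos hb, if_pos hb]; ring
          · rw [if_neg hb, if_neg hb]; ring
        · rw [Finset.sum_comm]
          refine Finset.sum_congr rfl fun b _ => ?_
          rw [Finset.mul_sum, Finset.mul_sum]
          refine Finset.sum_congr rfl fun a _ => ?_
          by_cases hb : 1 ≤ b ∧ b < g₂ ∧ b ≤ d
          · rw [if_pos hb, if_pos hb]; ring
          · rw [if_neg hb, if_neg hb]; ring
      · rw [Finset.sum_comm]
        refine Finset.sum_congr rfl fun b _ => ?_
        by_cases hP : g₂ ≤ b ∧ b ≤ d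
        · simp only [if_pos hP]
          rw [Finset.mul_sum, Finset.mul_sum, ← Finset.sum_add_distrib, Finset.mul_sum]
          exact Finset.sum_congr rfl fun a _ => by ring
        · simp only [if_neg hP]
          rw [mul_zero]
          exact Finset.sum_eq_zero fun a _ => by ring
    · rw [← Finset.sum_mul_sum]

/-- the top-hole heaviness is automatic two units below the top low: `T₁ − 2d ≥ 2`, `T₁ − d < j₀ < T₁ + T₂ − d`, `T₂ ≤ 2`
⟹ `usage y T₁ j₀ d j₀ ≥ 1`. [this work] -/
theorem subtwo_hole_heavy_of_two_le_depth (y T₁ T₂ : ℝ) (d j₀ : ℕ) (hy0 : 0 < y) (hy1 : y < 1) (hT22 : T₂ ≤ 2)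
    (hlow : 2 * (d : ℝ) < T₁) (hj0 : (j₀ : ℝ) < T₁ + T₂ - d) (hs : 2 ≤ T₁ - 2 * (d : ℝ)) (hhole : T₁ - d < (j₀ : ℝ)) :
    1 ≤ usage y T₁ j₀ d j₀ := by
  have hcomp : T₁ < (d : ℝ) + j₀ := by linarith
  refine le_trans ?_ (heavy_le_usage y T₁ j₀ d j₀ hy0 hy1 le_rfl hlow hcomp)
  rw [le_div_iff₀ (by linarith)]
  linarith

end LawDec

end Quant

end Summit.CriticalPhenomena.PercolationContinuityZ3.Theorems
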